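import Summits.QuantumFields.YangMills.Theorems.BalabanLadderUVSeamRecCeilingsDLRPeeling
import HarnessLib

/-!
# Crux `UVSeamRec` (stmt-QuantumFields-20043), lane B: the WINDOW CELL LAW at level `k` on every odd torus holding the collar cube,
# from the one-box uniform conditional rarity bound (UCR_k) — thinning + DLR-peeling (no reflection positivity, no divisibility)

Helper file (`--supports stmt-QuantumFields-20043`) of the width-lever seat `ym-20043-ceilings-p2` (lane B, gen 6); sequel of
`…CeilingsDLRPeeling` (§1 the peeling engine `torusE_prod_le_prod_of_kerE_le`, §2 the link supports of the block-field events).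

§3 THINNING (`exists_windowDisjoint_subfamily`): a window family `A` of level-`k` block-plaquettes on the odd torus `2L+1` (footprints in
`[o, o + 2L+1)⁴`), collar `m`, torus holding the collar cube (`(2m+1)b^k + 3 ≤ 2L+1`) has a subfamily `A'` with `#A ≤ 256(2m+4)⁴·#A'`
whose collar cubes (corner `b^k(y − m)`, side `(2m+1)b^k`) are pairwise window-disjoint and sit in ONE torus window (colour by
orientation, bulk/high position bits, `y mod (2m+4)`).  §4 ASSEMBLY (`torusE_prod_indicator_largeField_le_of_uniformKernelBound`):
`SU(N)`, any lattice representation, any `β`, `m ≥ b`, `w ∈ [0,1]` with (UCR_k) `∀ y μ<ν η, kerE^η_{collar cube}(1_{largeFieldEvent 𝔟 ε (k,y,μ,ν)}) ≤ w`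
⇒ for every window family (the hWCL binder of p554392 verbatim) `⟨∏_{γ∈A} 1_{E_γ}∘lift⟩_{2L+1,β} ≤ ∏_{γ∈A} w^{1/(256(2m+4)⁴)}`;
`windowCellLaw_of_uniformConditionalRarity` is the same in the letters of the hWCL binder (`∀ L ≥ 1` guarded by the collar-cube fit).

HONEST FRAMING: a REDUCTION of lane B's supplier target to ONE b-adic box with Dirichlet data (no torus ⇒ no seam, no divisibility; no RP).
(UCR_k) itself is Bałaban-size OPEN content ([Balaban1989LargeFieldII] R-operation currency with boundary conditions, not printed) and is
classically inconsistent for thresholds `ε < 1 − cos(π²/(2m+1)²) ≈ π⁴/(2(2m+1)⁴)` (flat penetration: coarse plaquette angle up to `π²/(2m+1)²`,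
LEAD 20043 FINDING #50; `2.0·10⁻², 3.3·10⁻³, 9.6·10⁻⁴` at `m = 3, 5, 7`).  At the (RM) torus (`4R+8 ≤ L`) the
fit guard holds for every family-shell level (`2b^k ≤ R`) as soon as `m ≤ 7`.  Nothing of E0′; not a gap, not Clay.
References: Georgii 2011 (4.18), Rem. 1.24; Friedli–Velenik 2017 (6.34); T. Bałaban, Commun. Math. Phys. 122 (1989) 355–392; folklore.
-/

set_option autoImplicit false

noncomputable section

open MeasureTheory Filter Topology Finset
open Literature.Probability.LatticeModels
open Literature.MathematicalPhysics.QuantumFieldTheory (GaugeConfig wilsonMeasure LatticeRep isProbabilityMeasure_wilsonMeasure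
  measurable_torusLift)
open Literature.MathematicalPhysics.QuantumLattice (LGConfig torusLift IsCylinder ymSpecification isProbabilityMeasure_ymSpecification
  integrable_of_abs_le)

namespace Summit.QuantumFields.YangMills.Cruxes.UVSeamRec.DLRPeeling

open Summit.QuantumFields.YangMills.Cruxes.OSLegsFromFemtoAndGap.DlrCollarTransfer
open Summit.QuantumFields.YangMills.Cruxes.UVSeamRec.PolymerData

/-! ## §3 Thinning a window family into window-disjoint, torus-fitting colour classes -/

section Thinning

/-- Pigeonhole: a finite family coloured by a finite type has a colour class of size at least `#A / #colours`. [folklore] -/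
theorem exists_fiber_card_mul_le {α κ : Type*} [Fintype κ] [DecidableEq κ] [Nonempty κ] (A : Finset α) (f : α → κ) :
    ∃ c : κ, A.card ≤ Fintype.card κ * (A.filter fun a => f a = c).card := by
  classical
  have hsum : ∑ c : κ, (A.filter fun a => f a = c).card = A.card :=
    (Finset.card_eq_sum_card_fiberwise (f := f) (s := A) (t := Finset.univ) fun _ _ => Finset.mem_univ _).symm
  by_contra hcon
  have hcon' : ∀ c : κ, Fintype.card κ * (A.filter fun a => f a = c).card < A.card :=
    fun c => lt_of_not_ge fun h => hcon ⟨c, h⟩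
  have hlt : ∑ c : κ, Fintype.card κ * (A.filter fun a => f a = c).card < ∑ _c : κ, A.card :=
    Finset.sum_lt_sum_of_nonempty Finset.univ_nonempty fun c _ => hcon' c
  rw [← Finset.mul_sum, hsum, Finset.sum_const, Finset.card_univ, smul_eq_mul] at hlt
  exact lt_irrefl _ hlt

/-- **THINNING.**  A window family `A` of level-`k` block-plaquettes on the odd torus `2L+1` (footprints in the period window
`[o, o + 2L+1)⁴`), collar `m`, torus holding the collar cube (`(2m+1)b^k + 3 ≤ 2L+1`).  Then a subfamily `A' ⊆ A` with
`#A ≤ 256(2m+4)⁴·#A'` has (i) pairwise WINDOW-DISJOINT collar cubes (corner `b^k(y − m)`, side `(2m+1)b^k`: separated by a lattice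
layer in some coordinate) and (ii) all collar cubes inside ONE torus window `lo + [1, 2L − 1 − side]`.  Colour by (orientation, the
`bulk/high` position bits of the anchor in the period window, `y mod (2m+4)`): same colour and distinct ⇒ some block coordinate differs by
`≥ 2m+4`; in a `high` coordinate same colour forces the SAME anchor coordinate (the high strip holds `< 2m+4` anchors), so the
common window exists. [folklore] -/
theorem exists_windowDisjoint_subfamily (𝔟 : BlockSize) (m k L : ℕ) (hfit : (2 * m + 1) * 𝔟.b ^ k + 3 ≤ 2 * L + 1)
    (o : Fin 4 → ℤ) (A : Finset Polymer) (hA : ∀ γ ∈ A, γ.k = k)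
    (hwin : ∀ γ ∈ A, ∀ c, o c ≤ anchor 𝔟 γ c ∧ anchor 𝔟 γ c + (𝔟.b : ℤ) ^ k ≤ o c + (2 * L + 1)) :
    ∃ A' ⊆ A, A.card ≤ 256 * (2 * m + 4) ^ 4 * A'.card ∧ ∃ lo : Fin 4 → ℤ,
      (∀ γ ∈ A', ∀ j, lo j + 1 ≤ (𝔟.b : ℤ) ^ k * (γ.y j - m) ∧
        (𝔟.b : ℤ) ^ k * (γ.y j - m) + (((2 * m + 1) * 𝔟.b ^ k : ℕ) : ℤ) + 2 ≤ lo j + (2 * L + 1 : ℕ)) ∧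
      (∀ γ ∈ A', ∀ γ' ∈ A', γ ≠ γ' → ∃ j,
        (𝔟.b : ℤ) ^ k * (γ.y j - m) + (((2 * m + 1) * 𝔟.b ^ k : ℕ) : ℤ) + 1 ≤ (𝔟.b : ℤ) ^ k * (γ'.y j - m) ∨
        (𝔟.b : ℤ) ^ k * (γ'.y j - m) + (((2 * m + 1) * 𝔟.b ^ k : ℕ) : ℤ) + 1 ≤ (𝔟.b : ℤ) ^ k * (γ.y j - m)) := by
  classical
  haveI : NeZero (2 * m + 4) := ⟨by omega⟩
  -- the colouring
  let bulk : Polymer → Fin 4 → Bool := fun γ j =>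
    decide (anchor 𝔟 γ j ≤ o j + 2 * L - ((2 * m + 1) * 𝔟.b ^ k : ℕ) - 2)
  let col : Polymer → Fin 4 × Fin 4 × (Fin 4 → Bool) × (Fin 4 → ZMod (2 * m + 4)) := fun γ =>
    (γ.μ, γ.ν, bulk γ, fun j => ((γ.y j : ℤ) : ZMod (2 * m + 4)))
  obtain ⟨c₀, hc₀⟩ := exists_fiber_card_mul_le A col
  have hK : Fintype.card (Fin 4 × Fin 4 × (Fin 4 → Bool) × (Fin 4 → ZMod (2 * m + 4))) = 256 * (2 * m + 4) ^ 4 := by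
    simp only [Fintype.card_prod, Fintype.card_fin, Fintype.card_pi, Fintype.card_bool, Finset.prod_const,
      Finset.card_univ, ZMod.card]
    ring
  set A' := A.filter fun a => col a = c₀ with hA'def
  have hA'A : A' ⊆ A := Finset.filter_subset _ _
  refine ⟨A', hA'A, by rw [hK] at hc₀; exact hc₀, ?_⟩
  have hcolA' : ∀ γ ∈ A', col γ = c₀ := fun γ hγ => (Finset.mem_filter.1 hγ).2
  -- basic sizes
  have hbk1 : (1 : ℤ) ≤ (𝔟.b : ℤ) ^ k := 𝔟.one_le_pow k
  have hside : (((2 * m + 1) * 𝔟.b ^ k : ℕ) : ℤ) = (2 * m + 1) * (𝔟.b : ℤ) ^ k := by push_cast; ring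
  have hfit' : (2 * (m : ℤ) + 1) * (𝔟.b : ℤ) ^ k + 3 ≤ 2 * L + 1 := by exact_mod_cast hfit
  -- two anchors in the high strip with congruent block coordinates coincide
  have high_eq : ∀ γ ∈ A', ∀ γ' ∈ A', ∀ j, bulk γ j = false → anchor 𝔟 γ j = anchor 𝔟 γ' j := by
    intro γ hγ γ' hγ' j hj
    have hγA := hA'A hγ
    have hγ'A := hA'A hγ'
    have hcc : col γ = col γ' := by rw [hcolA' γ hγ, hcolA' γ' hγ']
    have hbulk' : bulk γ' j = false := by
      have : (col γ).2.2.1 j = (col γ').2.2.1 j := by rw [hcc]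
      simpa [col, hj] using this.symm
    have hmod : ((γ.y j : ℤ) : ZMod (2 * m + 4)) = ((γ'.y j : ℤ) : ZMod (2 * m + 4)) := by
      have : (col γ).2.2.2 j = (col γ').2.2.2 j := by rw [hcc]
      simpa [col] using this
    have hdvd : ((2 * m + 4 : ℕ) : ℤ) ∣ γ'.y j - γ.y j := (ZMod.intCast_eq_intCast_iff_dvd_sub _ _ _).1 hmod
    have h1 : ¬ (anchor 𝔟 γ j ≤ o j + 2 * L - ((2 * m + 1) * 𝔟.b ^ k : ℕ) - 2) := by
      simpa [bulk] using hj
    have h2 : ¬ (anchor 𝔟 γ' j ≤ o j + 2 * L - ((2 * m + 1) * 𝔟.b ^ k : ℕ) - 2) := by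
      simpa [bulk] using hbulk'
    rw [hside] at h1 h2
    push Not at h1 h2
    have hw := (hwin γ hγA j).2
    have hw' := (hwin γ' hγ'A j).2
    have hk := hA γ hγA
    have hk' := hA γ' hγ'A
    simp only [anchor, hk, hk'] at h1 h2 hw hw' ⊢
    -- `b^k |y − y'| ≤ 2m b^k + 2 < (2m+4) b^k`
    have hlt : |γ'.y j - γ.y j| < (2 * m + 4 : ℕ) := by
      rw [abs_lt]
      push_cast
      constructor
      · by_contra hcon
        push Not at hcon
        have : (𝔟.b : ℤ) ^ k * (γ'.y j - γ.y j) ≤ (𝔟.b : ℤ) ^ k * (-(2 * (m : ℤ) + 4)) :=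
          mul_le_mul_of_nonneg_left hcon (by linarith)
        nlinarith
      · by_contra hcon
        push Not at hcon
        have : (𝔟.b : ℤ) ^ k * (2 * (m : ℤ) + 4) ≤ (𝔟.b : ℤ) ^ k * (γ'.y j - γ.y j) :=
          mul_le_mul_of_nonneg_left hcon (by linarith)
        nlinarith
    have h0 : γ'.y j - γ.y j = 0 := Int.eq_zero_of_abs_lt_dvd hdvd (by exact_mod_cast hlt)
    rw [show γ'.y j = γ.y j by linarith]
  -- the common window
  rcases A'.eq_empty_or_nonempty with hA'e | ⟨γ₀, hγ₀⟩
  · refine ⟨fun _ => 0, ?_, ?_⟩ <;> simp [hA'e]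
  refine ⟨fun j => (if bulk γ₀ j then o j else anchor 𝔟 γ₀ j) - m * (𝔟.b : ℤ) ^ k - 1, ?_, ?_⟩
  · intro γ hγ j
    have hγA := hA'A hγ
    have hk := hA γ hγA
    have hw := hwin γ hγA j
    have hcc : bulk γ j = bulk γ₀ j := by
      have : (col γ).2.2.1 j = (col γ₀).2.2.1 j := by rw [hcolA' γ hγ, hcolA' γ₀ hγ₀]
      simpa [col] using this
    rw [hside]
    push_cast
    have e2 : (𝔟.b : ℤ) ^ k * (γ.y j - m) = (𝔟.b : ℤ) ^ k * γ.y j - (m : ℤ) * (𝔟.b : ℤ) ^ k := by ring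
    rw [e2]
    cases hb : bulk γ₀ j
    · -- high coordinate: the anchor is the common one
      simp only [Bool.false_eq_true, if_false]
      have heq := high_eq γ hγ γ₀ hγ₀ j (hcc.trans hb)
      rw [← heq]
      simp only [anchor, hk]
      constructor
      · linarith
      · linarith
    · -- bulk coordinate
      simp only [if_true]
      have hbulk : anchor 𝔟 γ j ≤ o j + 2 * L - ((2 * m + 1) * 𝔟.b ^ k : ℕ) - 2 := by
        have : bulk γ j = true := hcc.trans hb
        simpa [bulk] using this
      rw [hside] at hbulk
      simp only [anchor, hk] at hw hbulk
      constructor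
      · linarith [hw.1]
      · linarith [hw.2]
  · intro γ hγ γ' hγ' hne
    have hγA := hA'A hγ
    have hγ'A := hA'A hγ'
    have hcc : col γ = col γ' := by rw [hcolA' γ hγ, hcolA' γ' hγ']
    have hμ : γ.μ = γ'.μ := by have := congrArg Prod.fst hcc; simpa [col] using this
    have hν : γ.ν = γ'.ν := by have := congrArg (fun t => t.2.1) hcc; simpa [col] using this
    have hk : γ.k = γ'.k := by rw [hA γ hγA, hA γ' hγ'A]
    -- distinct members of one colour class differ in some block coordinate
    have hy : ∃ j, γ.y j ≠ γ'.y j := by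
      by_contra hcon
      push Not at hcon
      apply hne
      obtain ⟨k₁, y₁, μ₁, ν₁, h₁⟩ := γ
      obtain ⟨k₂, y₂, μ₂, ν₂, h₂⟩ := γ'
      simp only at hk hμ hν hcon
      subst hk; subst hμ; subst hν
      have : y₁ = y₂ := funext hcon
      subst this
      rfl
    obtain ⟨j, hj⟩ := hy
    have hmod : ((γ.y j : ℤ) : ZMod (2 * m + 4)) = ((γ'.y j : ℤ) : ZMod (2 * m + 4)) := by
      have : (col γ).2.2.2 j = (col γ').2.2.2 j := by rw [hcc]
      simpa [col] using this
    have hdvd : ((2 * m + 4 : ℕ) : ℤ) ∣ γ'.y j - γ.y j := (ZMod.intCast_eq_intCast_iff_dvd_sub _ _ _).1 hmod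
    obtain ⟨q, hq⟩ := hdvd
    refine ⟨j, ?_⟩
    rw [hside]
    rcases lt_trichotomy q 0 with hq0 | hq0 | hq0
    · right
      have hq1 : q ≤ -1 := by omega
      have : γ'.y j - γ.y j ≤ -((2 * m + 4 : ℕ) : ℤ) := by rw [hq]; push_cast; nlinarith
      push_cast at this
      nlinarith
    · exact absurd (by rw [hq0, mul_zero, sub_eq_zero] at hq; exact hq.symm) hj
    · left
      have hq1 : 1 ≤ q := by omega
      have : ((2 * m + 4 : ℕ) : ℤ) ≤ γ'.y j - γ.y j := by rw [hq]; push_cast; nlinarith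
      push_cast at this
      nlinarith

end Thinning

/-! ## §4 Assembly: (UCR_k) ⇒ the window cell law at level `k` on every torus holding the collar cube -/

section Assembly

variable {N : ℕ} [NeZero N] (r : LatticeRep (Matrix.specialUnitaryGroup (Fin N) ℂ))

omit [NeZero N] in
/-- Dropping `[0,1]`-valued indicator factors increases a torus expectation (a copy of `TemperedResponse.torusE_prod_indicator_anti`
kept local to avoid the heavier import). [folklore] -/
theorem torusE_prod_indicator_anti' (β : ℝ) (L : ℕ) {κ : Type} (E : κ → Set (LGConfig 4 (Matrix.specialUnitaryGroup (Fin N) ℂ)))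
    (hE : ∀ γ, MeasurableSet (E γ)) {A A' : Finset κ} (h : A' ⊆ A) :
    torusE (Matrix.specialUnitaryGroup (Fin N) ℂ) r β L (fun U => ∏ γ ∈ A, (E γ).indicator (fun _ => (1 : ℝ)) U) ≤
      torusE (Matrix.specialUnitaryGroup (Fin N) ℂ) r β L (fun U => ∏ γ ∈ A', (E γ).indicator (fun _ => (1 : ℝ)) U) := by
  classical
  haveI := isProbabilityMeasure_wilsonMeasure (d := 4) (L := 2 * L + 1) r.ρ r.continuous β
  have hχ0 : ∀ γ (η : LGConfig 4 (Matrix.specialUnitaryGroup (Fin N) ℂ)), 0 ≤ (E γ).indicator (fun _ => (1 : ℝ)) η :=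
    fun γ η => Set.indicator_nonneg (fun _ _ => zero_le_one) _
  have hχ1 : ∀ γ (η : LGConfig 4 (Matrix.specialUnitaryGroup (Fin N) ℂ)), (E γ).indicator (fun _ => (1 : ℝ)) η ≤ 1 :=
    fun γ η => Set.indicator_apply_le' (fun _ => le_rfl) (fun _ => zero_le_one)
  have hpt : ∀ η : LGConfig 4 (Matrix.specialUnitaryGroup (Fin N) ℂ),
      ∏ γ ∈ A, (E γ).indicator (fun _ => (1 : ℝ)) η ≤ ∏ γ ∈ A', (E γ).indicator (fun _ => (1 : ℝ)) η := by
    intro η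
    rw [← Finset.prod_sdiff h]
    calc (∏ γ ∈ A \ A', (E γ).indicator (fun _ => (1 : ℝ)) η) * ∏ γ ∈ A', (E γ).indicator (fun _ => (1 : ℝ)) η
        ≤ 1 * ∏ γ ∈ A', (E γ).indicator (fun _ => (1 : ℝ)) η :=
          mul_le_mul_of_nonneg_right (Finset.prod_le_one (fun γ _ => hχ0 γ η) fun γ _ => hχ1 γ η)
            (Finset.prod_nonneg fun γ _ => hχ0 γ η)
      _ = _ := one_mul _
  have hmeas : ∀ B : Finset κ, Measurable fun U : GaugeConfig 4 (2 * L + 1) (Matrix.specialUnitaryGroup (Fin N) ℂ) =>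
      ∏ γ ∈ B, (E γ).indicator (fun _ => (1 : ℝ)) (torusLift (2 * L + 1) U) := fun B =>
    Finset.measurable_prod B fun γ _ => (measurable_const.indicator (hE γ)).comp (measurable_torusLift _)
  have hint : Integrable (fun U : GaugeConfig 4 (2 * L + 1) (Matrix.specialUnitaryGroup (Fin N) ℂ) =>
      ∏ γ ∈ A', (E γ).indicator (fun _ => (1 : ℝ)) (torusLift (2 * L + 1) U))
      (wilsonMeasure (d := 4) (L := 2 * L + 1) r.ρ β) := by
    refine integrable_of_abs_le (hmeas A') (C := 1) fun U => ?_
    rw [abs_of_nonneg (Finset.prod_nonneg fun γ _ => hχ0 γ _)]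
    exact Finset.prod_le_one (fun γ _ => hχ0 γ _) fun γ _ => hχ1 γ _
  unfold torusE
  exact integral_mono_of_nonneg (ae_of_all _ fun U => Finset.prod_nonneg fun γ _ => hχ0 γ _) hint
    (ae_of_all _ fun U => hpt _)

/-- **THE WINDOW CELL LAW FROM A UNIFORM CONDITIONAL RARITY BOUND (UCR_k) — on EVERY torus holding the collar cube, no reflection
positivity, no divisibility.**  `SU(N)`, any lattice representation `r`, any `β`; block size `𝔟`, collar `m ≥ b`, threshold `ε`, level
`k`, odd torus `2L+1` with `(2m+1)b^k + 3 ≤ 2L+1`; a weight `w ∈ [0,1]` such that for EVERY block index `y`, orientation `μ<ν` and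
EVERY exterior `η`, the cube-kernel probability of N20's large-field event of `(k, y, μ, ν)` in the collar cube (corner `b^k(y − m)`,
side `(2m+1)b^k`) is at most `w`:  `kerE^η(1_{largeFieldEvent 𝔟 ε (k,y,μ,ν)}) ≤ w`  (UCR_k).  Then for every window origin `o` and
every finite family `A` of level-`k` block-plaquettes whose blocks fit in the period window `[o, o+2L+1)⁴` (the binder of hWCL
verbatim):  `⟨∏_{γ∈A} 1_{largeFieldEvent 𝔟 ε γ}∘lift⟩_{2L+1,β} ≤ ∏_{γ∈A} w^{1/(256(2m+4)⁴)}`.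
Proof: thin `A` to a window-disjoint, torus-fitting colour class `A'` (`exists_windowDisjoint_subfamily`), drop the other factors, peel
(`torusE_prod_le_prod_of_kerE_le`, supports by `isCylinder_indicator_largeFieldEvent`/`chartBox_window`), and `w^{#A'} ≤ w^{#A/K}`.
HONEST FRAMING: a REDUCTION — (UCR_k) is the open one-box large-field estimate (Bałaban's R-operation currency with Dirichlet data),
classically inconsistent for `ε < 1 − cos(π²/(2m+1)²) ≈ π⁴/(2(2m+1)⁴)` (flat penetration, LEAD FINDING #50); nothing of E0′. [folklore] -/
theorem torusE_prod_indicator_largeField_le_of_uniformKernelBound (β : ℝ) (𝔟 : BlockSize) (m : ℕ) (hm : 𝔟.b ≤ m) (ε : ℝ)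
    (k L : ℕ) (hfit : (2 * m + 1) * 𝔟.b ^ k + 3 ≤ 2 * L + 1) (w : ℝ) (hw0 : 0 ≤ w) (hw1 : w ≤ 1)
    (hUCR : ∀ (y : Fin 4 → ℤ) (μ ν : Fin 4) (h : μ < ν) (η : LGConfig 4 (Matrix.specialUnitaryGroup (Fin N) ℂ)),
      kerE (Matrix.specialUnitaryGroup (Fin N) ℂ) r β (fun i => (𝔟.b : ℤ) ^ k * (y i - m)) ((2 * m + 1) * 𝔟.b ^ k) η
        ((largeFieldEvent (N := N) 𝔟 ε ⟨k, y, μ, ν, h⟩).indicator fun _ => (1 : ℝ)) ≤ w)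
    (o : Fin 4 → ℤ) (A : Finset Polymer) (hA : ∀ γ ∈ A, γ.k = k)
    (hwin : ∀ γ ∈ A, ∀ c, o c ≤ anchor 𝔟 γ c ∧ anchor 𝔟 γ c + (𝔟.b : ℤ) ^ k ≤ o c + (2 * L + 1)) :
    torusE (Matrix.specialUnitaryGroup (Fin N) ℂ) r β L (fun U => ∏ γ ∈ A,
        (largeFieldEvent (N := N) 𝔟 ε γ).indicator (fun _ => (1 : ℝ)) U) ≤
      ∏ _γ ∈ A, w ^ ((1 : ℝ) / (256 * (2 * m + 4) ^ 4)) := by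
  classical
  haveI := isProbabilityMeasure_wilsonMeasure (d := 4) (L := 2 * L + 1) r.ρ r.continuous β
  obtain ⟨A', hA'A, hcard, lo, hlo, hdisj⟩ := exists_windowDisjoint_subfamily 𝔟 m k L hfit o A hA hwin
  set E : Polymer → Set (LGConfig 4 (Matrix.specialUnitaryGroup (Fin N) ℂ)) := fun γ => largeFieldEvent (N := N) 𝔟 ε γ with hEdef
  -- drop the other members
  have hmono := torusE_prod_indicator_anti' r β L E (fun γ => measurableSet_largeFieldEvent (N := N) 𝔟 ε γ) hA'A
  -- peel the colour class
  have hpeel : torusE (Matrix.specialUnitaryGroup (Fin N) ℂ) r β L (fun U => ∏ γ ∈ A', (E γ).indicator (fun _ => (1 : ℝ)) U) ≤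
      ∏ _γ ∈ A', w := by
    refine torusE_prod_le_prod_of_kerE_le (Matrix.specialUnitaryGroup (Fin N) ℂ) r β L lo A'
      (fun γ i => (𝔟.b : ℤ) ^ k * (γ.y i - m)) (fun _ => (2 * m + 1) * 𝔟.b ^ k) hlo hdisj
      (fun γ => (E γ).indicator fun _ => (1 : ℝ)) (fun γ _ => measurable_const.indicator (measurableSet_largeFieldEvent (N := N) 𝔟 ε γ))
      (fun γ _ U => ⟨Set.indicator_nonneg (fun _ _ => zero_le_one) _,
        Set.indicator_apply_le' (fun _ => le_rfl) (fun _ => zero_le_one)⟩)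
      (fun γ => (Fintype.piFinset fun i => Finset.Ico (chartOrigin 𝔟 γ.k γ.y i)
        (chartOrigin 𝔟 γ.k γ.y i + (chartParams 𝔟 γ.k).sitesPerDir 0)) ×ˢ (Finset.univ : Finset (Fin 4)))
      (fun γ _ => isCylinder_indicator_largeFieldEvent (N := N) 𝔟 ε γ) (fun γ hγ e he j => ?_) (fun _ => w) (fun _ _ => hw0)
      (fun γ hγ η => ?_)
    · have hk := hA γ (hA'A hγ)
      have h := chartBox_window 𝔟 m hm γ.k γ.y he j
      rw [hk] at h
      exact h
    · have hk := hA γ (hA'A hγ)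
      obtain ⟨kk, y, μ, ν, h⟩ := γ
      simp only at hk
      subst hk
      exact hUCR y μ ν h η
  rw [Finset.prod_const] at hpeel
  -- assembly: `w^{#A'} ≤ w^{#A/K}`
  set K : ℝ := 256 * (2 * (m : ℝ) + 4) ^ 4 with hKdef
  have hK0 : 0 < K := by rw [hKdef]; positivity
  have hexp : (A.card : ℝ) / K ≤ (A'.card : ℝ) := by
    rw [div_le_iff₀ hK0]
    have : (A.card : ℝ) ≤ ((256 * (2 * m + 4) ^ 4 * A'.card : ℕ) : ℝ) := by exact_mod_cast hcard
    push_cast at this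
    rw [hKdef]; linarith
  rw [Finset.prod_const]
  have hKcast : (256 * (2 * (m : ℝ) + 4) ^ 4 : ℝ) = K := rfl
  rw [show ((1 : ℝ) / (256 * (2 * m + 4) ^ 4)) = 1 / K by rw [hKdef]]
  rcases eq_or_lt_of_le hw0 with hw00 | hwpos
  · -- `w = 0`: either `A' = ∅` (then `A = ∅`) or the law is `≤ 0`
    rw [← hw00] at hpeel ⊢
    rcases Nat.eq_zero_or_pos A'.card with h0 | hpos
    · have hA0 : A.card = 0 := by
        have := hcard; rw [h0, mul_zero] at this; exact Nat.le_zero.1 this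
      rw [hA0, pow_zero]
      rw [Finset.card_eq_zero.1 hA0]
      simp only [Finset.prod_empty]
      unfold torusE
      rw [integral_const, smul_eq_mul, mul_one, probReal_univ]
    · rw [zero_pow (Nat.pos_iff_ne_zero.1 hpos)] at hpeel
      have hApos : A.card ≠ 0 := fun h => by
        have := Finset.card_le_card hA'A; rw [h] at this; omega
      rw [Real.zero_rpow (one_div_ne_zero hK0.ne'), zero_pow hApos]
      exact hmono.trans hpeel
  · rw [← Real.rpow_natCast (w ^ (1 / K)) A.card, ← Real.rpow_mul hw0,
      show 1 / K * (A.card : ℝ) = (A.card : ℝ) / K by ring]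
    refine hmono.trans (hpeel.trans ?_)
    rw [← Real.rpow_natCast w A'.card]
    exact Real.rpow_le_rpow_of_exponent_ge hwpos hw1 hexp

/-- **(UCR) ⇒ hWCL, in the letters of the window-cell-law binder** of `TemperedResponse.torusE_exp_two_mul_sum_influence_le_of_windowCellLaws`
(p554392), guarded by the collar-cube fit.  Block size `𝔟`, collar `m ≥ b`, thresholds `ε k`, weights `w k ∈ [0,1]` with the uniform
conditional rarity bound (UCR_k) at every level `k ≥ 1`; then for every odd torus `2L+1` (`L ≥ 1`), every level `k ≥ 1` with
`(2m+1)b^k + 3 ≤ 2L+1`, every window origin and every window family of level-`k` block-plaquettes: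
`⟨∏_{γ∈A} 1_{largeFieldEvent 𝔟 (ε k) γ}∘lift⟩_{2L+1,β} ≤ ∏_{γ∈A} (w k)^{1/(256(2m+4)⁴)}`.  At the (RM) torus (`4R+8 ≤ L`) the guard holds for
every family-shell level (`2b^k ≤ R`) when `m ≤ 7`.  HONEST FRAMING: reduction only; (UCR_k) is the open one-box estimate. [folklore] -/
theorem windowCellLaw_of_uniformConditionalRarity (β : ℝ) (𝔟 : BlockSize) (m : ℕ) (hm : 𝔟.b ≤ m) (ε w : ℕ → ℝ)
    (hw0 : ∀ k, 0 ≤ w k) (hw1 : ∀ k, w k ≤ 1)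
    (hUCR : ∀ k : ℕ, 1 ≤ k → ∀ (y : Fin 4 → ℤ) (μ ν : Fin 4) (h : μ < ν) (η : LGConfig 4 (Matrix.specialUnitaryGroup (Fin N) ℂ)),
      kerE (Matrix.specialUnitaryGroup (Fin N) ℂ) r β (fun i => (𝔟.b : ℤ) ^ k * (y i - m)) ((2 * m + 1) * 𝔟.b ^ k) η
        ((largeFieldEvent (N := N) 𝔟 (ε k) ⟨k, y, μ, ν, h⟩).indicator fun _ => (1 : ℝ)) ≤ w k) :
    ∀ L : ℕ, 1 ≤ L → ∀ k : ℕ, 1 ≤ k → (2 * m + 1) * 𝔟.b ^ k + 3 ≤ 2 * L + 1 → ∀ (o : Fin 4 → ℤ) (A : Finset Polymer),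
      (∀ γ ∈ A, γ.k = k) → (∀ γ ∈ A, ∀ c, o c ≤ anchor 𝔟 γ c ∧ anchor 𝔟 γ c + (𝔟.b : ℤ) ^ k ≤ o c + (2 * L + 1)) →
      torusE (Matrix.specialUnitaryGroup (Fin N) ℂ) r β L (fun U => ∏ γ ∈ A,
          (largeFieldEvent (N := N) 𝔟 (ε k) γ).indicator (fun _ => (1 : ℝ)) U) ≤
        ∏ _γ ∈ A, w k ^ ((1 : ℝ) / (256 * (2 * m + 4) ^ 4)) :=
  fun L _ k hk hfit o A hA hwin =>
    torusE_prod_indicator_largeField_le_of_uniformKernelBound r β 𝔟 m hm (ε k) k L hfit (w k) (hw0 k) (hw1 k) (hUCR k hk) o A hA hwin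

end Assembly

end Summit.QuantumFields.YangMills.Cruxes.UVSeamRec.DLRPeeling

end
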